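import Summits.QuantumFields.BalabanUV.Beta.GAN24.ExitFaceCurrentCellTotals
import Summits.QuantumFields.BalabanUV.Beta.GAN24.VHWordsZeroLatticeStep
import Summits.QuantumFields.BalabanUV.Beta.GAN24.ExitFaceHalfVertexSplit
import Summits.QuantumFields.BalabanUV.Beta.GAN24.ValueHessianCellAdjoint
import Summits.QuantumFields.BalabanUV.Beta.GAN24.ThreeFaceRecClosed

/-!
# `BalabanUV.Beta.GAN24.ExitFaceCurrentCellTotalsStep` — binder row G-an2-4 ∕ (CONV-C), W-slot CT-W, conservation law (C)∕(C)sym AT LEVELS `j + 1 ≥ 1`, hypothesis (Z) of 24_{j+1}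
# DISCHARGED AT THE WARD PINS (this lineage's note `HOME/b2b-balaban-gan24-formalise-leaf-04/g68/EXIT-FACE-CURRENT-TOWER.md` §1 «E»): **THE BOND-RESUMMED EXIT-FACE CURRENT OF THE
# LEVEL-`(j+1)` VALUE-FUNCTION CUBIC SECTOR HAS ZERO CELL TOTALS** (`(cE, cVH) = (Lc^{d+1}, −½Lc^{2(d+1)})`, `3 ≤ Lc`, every `j`, every `cΛ`, all units) — hence **24_{j+1}
# (`VHWordsZeroLatticeStep`) HOLDS UNDER THE SINGLE HYPOTHESIS (D) «the current is divergence-free»**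

NOT IN PRINT; OUR BOOKKEEPING ([folklore] BY NAME: my D `ExitFaceCurrentCellTotals` (generic (Z)) and C `VHWordsZeroLatticeStep` (24_{j+1} ⟸ (D)∧(Z)); leaf-06 g52's
`ExitFaceHalfVertexSplit.faceSlot_e3OfK_split_sawtooth` (the face-summed slot of `e3OfK Lc G_j (SrecAt j)` at the Ward pins = `Lc⁻¹×` constant-slot sum `− (2Lc)⁻¹×` value-Hessian
commutator with the sawtooth), `ValueHessianLinearGauge.tsum_E2_mul_exitFace_eq_zero′ ∕ tsum_const_mul_E2_eq_zero`, `ValueHessianCellAdjoint.sum_box_E2apply_mul_periodic`; my g63 S3C-REC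
`ThreeFaceRecClosed.hasSum_unitS_SpureRecAt` (iii); an2's `BalabanStepJetsSucc.decays_E2`; G-an2-4 formalisation swarm, leaf prover `b2b-balaban-gan24-formalise-leaf-04`, gen 68).
HONEST FRAMING (cell contract, verbatim): «discharging `BetaPertH` makes Bałaban's UV stability UNCONDITIONAL — a real constructive-QFT result; it is NOT the continuum limit and NOT the
Clay problem.»  HONEST DEPENDENCY (verbatim): «continuum YM on T⁴ ⇐ BetaPertH ∧ nine spine estimates (0/9 proved); BetaPertH ⇐ (D1) ∧ (D4) ∧ CAP+tail; G-an2-4 gates asym, D1 and NE2/3/4.»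

WHAT ([folklore]; generic `d`, in-block root `ρ = toSite r`, `[NeZero Lc]`, `3 ≤ Lc`, every `j`, every `cΛ`, all units `s_f s_m`, THE WARD PINS `cE = Lc^{d+1}`, `cVH = −(Lc^{d+1}·½·Lc^{d+1})`;
0 `def`, 0 cited facts, 0 `def … : Prop`, 0 sorry), with `S^E_{j+1}`, `X̃♮_{j+1}`, `V^E_{ν,u}` as in C: §1 the five hypotheses of D's `sum_box_faceSlot_current_eq_zero` for `S := unitS s_f s_m S^E_{j+1}`,
`E z w := u·E2 d Lc (j+1) z w (inl b)(inl β)`, `λ w := w_ν % Lc` — `faceSlot_unitS_e3Sector_split` (hsplit), `hasSum_slotLeg_unitS_e3Sector` (hS3), `summable_abs_E2_row` (hErow),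
`tsum_E2_mul_face_eq_zero` (hEface), `sum_box_E2_face_sawtooth_eq_zero` (hEadj0); §2 **`sum_box_current_E_eq_zero`** (`Σ_{r′∈box Lc} T b (toSite r′) = 0` for the current of C, both the
`β`-read and, by renaming, any leg direction); §3 **`tsum_noFF_left_E_right_word_eq_zero_succ_of_divFree`** and **`tsum_E_left_noFF_right_swap_word_eq_zero_succ_of_divFree`** — 24_{j+1}
under (D) alone.  Asserts NO value of Bałaban's tables beyond an2's ∕ an1's DEFINED ones; discharges NOTHING of (C)sym ∕ (Q-D) ∕ (Q-D-rate) ∕ «T2Shape» ∕ «T2Drift» ∕ (hW, hWall); NEVER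
«G-an2-4 closed» as (CONV-C); NOT D1, NOT `BetaPertH`, NOT continuum, NOT Clay.  2026-08-23; no existing file touched.
-/

noncomputable section

open Finset
open scoped BigOperators
open Literature.MathematicalPhysics.QuantumFieldTheory
open Literature.MathematicalPhysics.QuantumFieldTheory.Balaban1983to89
open Literature.MathematicalPhysics.QuantumFieldTheory.Balaban1983to89.Beta
open B12Sec2to5 (l1)
open ExpKernelCalculus (Site MKer shiftK Decays summable_exp_shift)
open OneStepResolventKernel (Fib LocStencil)
open OneStepKernelFamily (KInvStep vertexOfK)
open BalabanStepJetsSucc (E2 decays_E2 wE wVH)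
open AffineAveraging (box toSite unitVec)
open PeriodicDescent (IsPeriodic)
open Summit.QuantumFields.BalabanUV.Beta.AxialDressingRooted (coDressKBmAt)
open Summit.QuantumFields.BalabanUV.Beta.HessKerDressedUnits (unitK unitS unitS_apply locStencil_unitS legScale_inl)
open Summit.QuantumFields.BalabanUV.Beta.SpineRooted (e3OfK SpureRecAt SpureRecAt_succ)
open Summit.QuantumFields.BalabanUV.Beta.WardLocusRecursive (SrecAt)
open Summit.QuantumFields.BalabanUV.Beta.GAN24.ExitFaceCurrentCellTotals (tsum_weight_current_eq_faceSlot sum_box_faceSlot_current_eq_zero)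
open Summit.QuantumFields.BalabanUV.Beta.GAN24.VHWordsZeroLatticeStep (exists_locStencil_e3Sector e3Sector_translate tsum_noFF_left_E_right_word_eq_zero_succ
  tsum_E_left_noFF_right_swap_word_eq_zero_succ)
open Summit.QuantumFields.BalabanUV.Beta.GAN24.ExitFaceHalfVertexSplit (faceSlot_e3OfK_split_sawtooth)
open Summit.QuantumFields.BalabanUV.Beta.GAN24.ValueHessianLinearGauge (tsum_E2_mul_exitFace_eq_zero' tsum_const_mul_E2_eq_zero)
open Summit.QuantumFields.BalabanUV.Beta.GAN24.ValueHessianCellAdjoint (sum_box_E2apply_mul_periodic)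
open Summit.QuantumFields.BalabanUV.Beta.GAN24.ThreeFaceRecClosed (hasSum_unitS_SpureRecAt)

namespace Summit.QuantumFields.BalabanUV.Beta.GAN24.ExitFaceCurrentCellTotalsStep

variable {d : ℕ} {Lc : ℕ} [NeZero Lc] {r : Fin (d + 1) → ℕ}

/-! ## §1 The five hypotheses of the generic cell-total theorem, for the unit-dressed cubic sector at the Ward pins -/

section Hyps

/-- [folklore] **(hsplit) THE FACE-SUMMED SLOT OF THE UNIT-DRESSED CUBIC SECTOR SPLITS** (leaf-06's `faceSlot_e3OfK_split_sawtooth` × the leg∕sector units): with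
`u = (s_f s_m)⁻¹·s_f⁻¹·s_f⁻¹·(cE·wE_{j+1})`, `Σ'_t χ_ν(t)·S ν t z w (inl b)(inl β) = Lc⁻¹·Σ'_t S ν t z w (inl b)(inl β) − (2Lc)⁻¹·(u·E2_{j+1}(z,w)_{bβ}·(λ(w) − λ(z)))`. -/
theorem faceSlot_unitS_e3Sector_split (hr : r ∈ box (d + 1) Lc) (sf sm cΛ : ℝ) (j : ℕ) (ν : Fin (d + 1)) (z w : Site (d + 1)) (b β : Fin (d + 1)) :
    ∑' t : Site (d + 1), (if t ν % (Lc : ℤ) = (Lc : ℤ) - 1 then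
        unitS sf sm (fun κ t => ((Lc : ℝ) ^ (d + 1) * wE d Lc (j + 1)) • e3OfK Lc (coDressKBmAt (toSite r) Lc (KInvStep (d := d) Lc j))
          (SrecAt d Lc (toSite r) ((Lc : ℝ) ^ (d + 1)) (-((Lc : ℝ) ^ (d + 1) * (1 / 2) * (Lc : ℝ) ^ (d + 1))) cΛ j) κ t) ν t z w (Sum.inl b) (Sum.inl β) else 0) =
      (Lc : ℝ)⁻¹ * (∑' t : Site (d + 1), unitS sf sm (fun κ t => ((Lc : ℝ) ^ (d + 1) * wE d Lc (j + 1)) • e3OfK Lc (coDressKBmAt (toSite r) Lc (KInvStep (d := d) Lc j))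
          (SrecAt d Lc (toSite r) ((Lc : ℝ) ^ (d + 1)) (-((Lc : ℝ) ^ (d + 1) * (1 / 2) * (Lc : ℝ) ^ (d + 1))) cΛ j) κ t) ν t z w (Sum.inl b) (Sum.inl β))
        - (2 * (Lc : ℝ))⁻¹ * (((sf * sm)⁻¹ * (sf⁻¹ * sf⁻¹) * ((Lc : ℝ) ^ (d + 1) * wE d Lc (j + 1)) * E2 d Lc (j + 1) z w (Sum.inl b) (Sum.inl β)) *
            ((((w ν % (Lc : ℤ) : ℤ) : ℝ)) - (((z ν % (Lc : ℤ) : ℤ) : ℝ)))) := by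
  have h := faceSlot_e3OfK_split_sawtooth (d := d) hr cΛ j ν z w b β
  have e : ∀ t : Site (d + 1), (if t ν % (Lc : ℤ) = (Lc : ℤ) - 1 then
      unitS sf sm (fun κ t => ((Lc : ℝ) ^ (d + 1) * wE d Lc (j + 1)) • e3OfK Lc (coDressKBmAt (toSite r) Lc (KInvStep (d := d) Lc j))
        (SrecAt d Lc (toSite r) ((Lc : ℝ) ^ (d + 1)) (-((Lc : ℝ) ^ (d + 1) * (1 / 2) * (Lc : ℝ) ^ (d + 1))) cΛ j) κ t) ν t z w (Sum.inl b) (Sum.inl β) else 0) =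
      ((sf * sm)⁻¹ * (sf⁻¹ * sf⁻¹) * ((Lc : ℝ) ^ (d + 1) * wE d Lc (j + 1))) *
        (if t ν % (Lc : ℤ) = (Lc : ℤ) - 1 then e3OfK Lc (coDressKBmAt (toSite r) Lc (KInvStep (d := d) Lc j))
          (SrecAt d Lc (toSite r) ((Lc : ℝ) ^ (d + 1)) (-((Lc : ℝ) ^ (d + 1) * (1 / 2) * (Lc : ℝ) ^ (d + 1))) cΛ j) ν t z w (Sum.inl b) (Sum.inl β) else 0) := by
    intro t
    split_ifs
    · simp only [unitS_apply, legScale_inl, Pi.smul_apply, smul_eq_mul]; ring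
    · rw [mul_zero]
  have e' : ∀ t : Site (d + 1), unitS sf sm (fun κ t => ((Lc : ℝ) ^ (d + 1) * wE d Lc (j + 1)) • e3OfK Lc (coDressKBmAt (toSite r) Lc (KInvStep (d := d) Lc j))
        (SrecAt d Lc (toSite r) ((Lc : ℝ) ^ (d + 1)) (-((Lc : ℝ) ^ (d + 1) * (1 / 2) * (Lc : ℝ) ^ (d + 1))) cΛ j) κ t) ν t z w (Sum.inl b) (Sum.inl β) =
      ((sf * sm)⁻¹ * (sf⁻¹ * sf⁻¹) * ((Lc : ℝ) ^ (d + 1) * wE d Lc (j + 1))) *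
        e3OfK Lc (coDressKBmAt (toSite r) Lc (KInvStep (d := d) Lc j))
          (SrecAt d Lc (toSite r) ((Lc : ℝ) ^ (d + 1)) (-((Lc : ℝ) ^ (d + 1) * (1 / 2) * (Lc : ℝ) ^ (d + 1))) cΛ j) ν t z w (Sum.inl b) (Sum.inl β) := by
    intro t
    simp only [unitS_apply, legScale_inl, Pi.smul_apply, smul_eq_mul]; ring
  rw [tsum_congr e, tsum_mul_left, h, tsum_congr e', tsum_mul_left]
  ring

/-- [folklore] **(hS3) THE (SLOT + SECOND LEG) CONSTANT SUM OF THE UNIT-DRESSED CUBIC SECTOR VANISHES** at every first leg (my g63 S3C-REC (iii) for `unitS s_f s_m (SpureRecAt … (j+1))`,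
whose border sector has no ff block; `3 ≤ Lc`, all `cE cVH cΛ`). -/
theorem hasSum_slotLeg_unitS_e3Sector (hLc : 3 ≤ Lc) (hr : r ∈ box (d + 1) Lc) (sf sm cE cVH cΛ : ℝ) (j : ℕ) (ν b β : Fin (d + 1)) (z : Site (d + 1)) :
    HasSum (fun tw : Site (d + 1) × Site (d + 1) =>
      unitS sf sm (fun κ t => (cE * wE d Lc (j + 1)) • e3OfK Lc (coDressKBmAt (toSite r) Lc (KInvStep (d := d) Lc j)) (SrecAt d Lc (toSite r) cE cVH cΛ j) κ t)
        ν tw.1 z tw.2 (Sum.inl b) (Sum.inl β)) 0 := by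
  have h := (hasSum_unitS_SpureRecAt (d := d) hLc hr cE cVH cΛ (j + 1) sf sm ν b β z).2.2
  refine h.congr_fun fun tw => ?_
  simp only [unitS_apply, SpureRecAt_succ, Pi.add_apply, Pi.smul_apply, smul_eq_mul]
  rw [show AveragingHessianKernelsRooted.vhSAt (toSite r) d Lc rfl ν tw.1 z tw.2 (Sum.inl b) (Sum.inl β) = 0 from rfl]
  ring

/-- [folklore] **(hErow)** the rows of (a multiple of) the value Hessian are absolutely summable (`decays_E2`). -/
theorem summable_abs_E2_row (j : ℕ) (u : ℝ) (z : Site (d + 1)) (b β : Fin (d + 1)) :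
    Summable fun w : Site (d + 1) => |u * E2 d Lc j z w (Sum.inl b) (Sum.inl β)| := by
  obtain ⟨δ, C, hδ, hC, hE⟩ := decays_E2 (d := d) (Lc := Lc) j
  refine Summable.of_nonneg_of_le (fun _ => abs_nonneg _) (fun w => ?_) ((summable_exp_shift hδ z).mul_left (|u| * C))
  rw [abs_mul, mul_assoc]
  exact mul_le_mul_of_nonneg_left (hE z w _ _) (abs_nonneg _)

/-- [folklore] **(hEface)** the value Hessian kills the exit-face leg weight (leaf-06's `tsum_E2_mul_exitFace_eq_zero′`). -/
theorem tsum_E2_mul_face_eq_zero (j : ℕ) (u : ℝ) (z : Site (d + 1)) (b β : Fin (d + 1)) :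
    ∑' w : Site (d + 1), (u * E2 d Lc j z w (Sum.inl b) (Sum.inl β)) * (if w β % (Lc : ℤ) = (Lc : ℤ) - 1 then (1 : ℝ) else 0) = 0 := by
  have h := tsum_E2_mul_exitFace_eq_zero' (d := d) (Lc := Lc) j (N := Lc) (Nat.one_le_iff_ne_zero.mpr (NeZero.ne Lc)) b β z 1
  have e : ∀ w : Site (d + 1), (u * E2 d Lc j z w (Sum.inl b) (Sum.inl β)) * (if w β % (Lc : ℤ) = (Lc : ℤ) - 1 then (1 : ℝ) else 0) =
      u * (E2 d Lc j z w (Sum.inl b) (Sum.inl β) * (if w β % (Lc : ℤ) = (Lc : ℤ) - 1 then (1 : ℝ) else 0)) := fun w => by ring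
  rw [tsum_congr e, tsum_mul_left, h, mul_zero]

/-- [folklore] **(hEadj0)** against the periodic bounded weight `χ_β·λ` the cell-summed rows of the value Hessian are its cell-summed columns against `χ_β·λ` (leaf-06's cell
adjointness `sum_box_E2apply_mul_periodic`), and the columns kill constants (`tsum_const_mul_E2_eq_zero`): `Σ_{z∈box} Σ'_w (u·E2(toSite z, w)_{bβ})·(χ_β(w)·λ(w)) = 0`. -/
theorem sum_box_E2_face_sawtooth_eq_zero (j : ℕ) (u : ℝ) (ν b β : Fin (d + 1)) :
    ∑ z ∈ box (d + 1) Lc, ∑' w : Site (d + 1), (u * E2 d Lc j (toSite z) w (Sum.inl b) (Sum.inl β)) *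
        ((if w β % (Lc : ℤ) = (Lc : ℤ) - 1 then (1 : ℝ) else 0) * (((w ν % (Lc : ℤ) : ℤ) : ℝ))) = 0 := by
  classical
  have hL0 : (0 : ℤ) < (Lc : ℤ) := by exact_mod_cast Nat.pos_of_ne_zero (NeZero.ne Lc)
  -- the two weights: `p b′ w = [b′ = β]·χ_β(w)·λ(w)`, `Y a x = [a = b]·u`
  set p : Fin (d + 1) → Site (d + 1) → ℝ := fun b' w => if b' = β then (if w β % (Lc : ℤ) = (Lc : ℤ) - 1 then (1 : ℝ) else 0) * (((w ν % (Lc : ℤ) : ℤ) : ℝ)) else 0 with hp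
  set Y : Fin (d + 1) → Site (d + 1) → ℝ := fun a _ => if a = b then u else 0 with hY
  have hlamB : ∀ w : Site (d + 1), |(((w ν % (Lc : ℤ) : ℤ) : ℝ))| ≤ (Lc : ℝ) := by
    intro w
    rw [abs_of_nonneg (by exact_mod_cast Int.emod_nonneg _ hL0.ne')]
    exact_mod_cast (Int.emod_lt_of_pos (w ν) hL0).le
  have hχ : ∀ w : Site (d + 1), |(if w β % (Lc : ℤ) = (Lc : ℤ) - 1 then (1 : ℝ) else 0)| ≤ 1 := fun w => by split_ifs <;> simp
  have hB : ∀ (b' : Fin (d + 1)) (w : Site (d + 1)), |p b' w| ≤ max (Lc : ℝ) |u| := by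
    intro b' w
    by_cases hb : b' = β
    · have e : p b' w = (if w β % (Lc : ℤ) = (Lc : ℤ) - 1 then (1 : ℝ) else 0) * (((w ν % (Lc : ℤ) : ℤ) : ℝ)) := by simp only [hp, hb, if_true]
      rw [e, abs_mul]
      calc |(if w β % (Lc : ℤ) = (Lc : ℤ) - 1 then (1 : ℝ) else 0)| * |(((w ν % (Lc : ℤ) : ℤ) : ℝ))| ≤ 1 * (Lc : ℝ) :=
            mul_le_mul (hχ w) (hlamB w) (abs_nonneg _) zero_le_one
        _ ≤ max (Lc : ℝ) |u| := by rw [one_mul]; exact le_max_left _ _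
    · have e : p b' w = 0 := by simp only [hp, if_neg hb]
      rw [e, abs_zero]; positivity
  have hYB : ∀ (a : Fin (d + 1)) (x : Site (d + 1)), |Y a x| ≤ max (Lc : ℝ) |u| := by
    intro a x
    by_cases ha : a = b
    · have e : Y a x = u := by simp only [hY, ha, if_true]
      rw [e]; exact le_max_right _ _
    · have e : Y a x = 0 := by simp only [hY, if_neg ha]
      rw [e, abs_zero]; positivity
  have hpP : ∀ (b' : Fin (d + 1)) (y t : Site (d + 1)), p b' (y + (Lc : ℤ) • t) = p b' y := by
    intro b' y t
    simp only [hp, Pi.add_apply, Pi.smul_apply, smul_eq_mul, Int.add_mul_emod_self_left]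
  have hYP : ∀ (a : Fin (d + 1)) (x t : Site (d + 1)), Y a (x + (Lc : ℤ) • t) = Y a x := fun a x t => rfl
  have h := sum_box_E2apply_mul_periodic (d := d) (Lc := Lc) j (N := Lc) (p := p) (Y := Y) hpP hYP hB hYB
  -- read both sides
  have eL : ∀ x : Fin (d + 1) → ℕ, ∑ a : Fin (d + 1), (∑' y : Site (d + 1), ∑ b' : Fin (d + 1), E2 d Lc j (toSite x) y (Sum.inl a) (Sum.inl b') * p b' y) * Y a (toSite x) =
      ∑' w : Site (d + 1), (u * E2 d Lc j (toSite x) w (Sum.inl b) (Sum.inl β)) * ((if w β % (Lc : ℤ) = (Lc : ℤ) - 1 then (1 : ℝ) else 0) * (((w ν % (Lc : ℤ) : ℤ) : ℝ))) := by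
    intro x
    rw [Finset.sum_eq_single b (fun a _ ha => by simp only [hY, if_neg ha, mul_zero]) (fun hb => absurd (Finset.mem_univ b) hb)]
    simp only [hY, if_true]
    rw [mul_comm, ← tsum_mul_left]
    refine tsum_congr fun y => ?_
    rw [Finset.sum_eq_single β (fun b' _ hb' => by simp only [hp, if_neg hb', mul_zero]) (fun hb => absurd (Finset.mem_univ β) hb)]
    simp only [hp, if_true]
    ring
  have eR : ∀ r' : Fin (d + 1) → ℕ, ∑ b' : Fin (d + 1), p b' (toSite r') * ∑' x : Site (d + 1), ∑ a : Fin (d + 1), E2 d Lc j x (toSite r') (Sum.inl a) (Sum.inl b') * Y a x = 0 := by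
    intro r'
    refine Finset.sum_eq_zero fun b' _ => ?_
    have h0 := tsum_const_mul_E2_eq_zero (d := d) (Lc := Lc) j b' (toSite r') (fun a => if a = b then u else 0)
    have e : ∀ x : Site (d + 1), ∑ a : Fin (d + 1), E2 d Lc j x (toSite r') (Sum.inl a) (Sum.inl b') * Y a x =
        ∑ a : Fin (d + 1), (if a = b then u else 0) * E2 d Lc j x (toSite r') (Sum.inl a) (Sum.inl b') := fun x => Finset.sum_congr rfl fun a _ => by simp only [hY]; ring
    rw [tsum_congr e, h0, mul_zero]
  rw [Finset.sum_congr rfl fun x _ => eL x, Finset.sum_congr rfl fun r' _ => eR r', Finset.sum_const_zero] at h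
  exact h

end Hyps

/-! ## §2 The cell totals of the level-`(j+1)` exit-face current vanish at the Ward pins -/

section CellTotals

/-- [folklore] **THE BOND-RESUMMED EXIT-FACE CURRENT OF THE LEVEL-`(j+1)` CUBIC SECTOR HAS ZERO CELL TOTALS** (in-block root, `3 ≤ Lc`, every `j`, every `cΛ`, all units, the Ward pins,
every slot axis `ν` and leg axis `β`): `Σ_{r′ ∈ box Lc} Σ'_{(u′,w)} 𝟙f(w_β)·V^E_{ν,u′} (toSite r′) w (inl b)(inl β) = 0` — D's §1 (the current is the face-summed slot) and §3 with §1 above. -/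
theorem sum_box_current_E_eq_zero (hLc : 3 ≤ Lc) (hr : r ∈ box (d + 1) Lc) (sf sm cΛ : ℝ) (j : ℕ) (ν β b : Fin (d + 1)) :
    ∑ r' ∈ box (d + 1) Lc, ∑' uw : Site (d + 1) × Site (d + 1), (if uw.2 β % (Lc : ℤ) = (Lc : ℤ) - 1 then (1 : ℝ) else 0) *
      vertexOfK (unitK sf sm (coDressKBmAt (toSite r) Lc (KInvStep (d := d) Lc (j + 1)))) Lc
        (unitS sf sm (fun κ t => ((Lc : ℝ) ^ (d + 1) * wE d Lc (j + 1)) • e3OfK Lc (coDressKBmAt (toSite r) Lc (KInvStep (d := d) Lc j))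
          (SrecAt d Lc (toSite r) ((Lc : ℝ) ^ (d + 1)) (-((Lc : ℝ) ^ (d + 1) * (1 / 2) * (Lc : ℝ) ^ (d + 1))) cΛ j) κ t)) ν uw.1 (toSite r') uw.2
        (Sum.inl b) (Sum.inl β) = 0 := by
  have hLc1 : 1 ≤ Lc := le_trans (by norm_num) hLc
  obtain ⟨CE, δE, hδE, hSE⟩ := exists_locStencil_e3Sector (d := d) hLc1 hr ((Lc : ℝ) ^ (d + 1)) (-((Lc : ℝ) ^ (d + 1) * (1 / 2) * (Lc : ℝ) ^ (d + 1))) cΛ j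
  have hS := locStencil_unitS (sf := sf) (sm := sm) hSE
  have hχ : ∀ w : Site (d + 1), |(if w β % (Lc : ℤ) = (Lc : ℤ) - 1 then (1 : ℝ) else 0)| ≤ 1 := fun w => by split_ifs <;> simp
  simp only [tsum_weight_current_eq_faceSlot hLc1 hr sf sm (j + 1) hS hδE hχ ν _ (Sum.inl b) (Sum.inl β)]
  rw [← Finset.mul_sum]
  refine mul_eq_zero_of_right _ ?_
  have hScov : ∀ (κ : Fin (d + 1)) (t v : Site (d + 1)),
      unitS sf sm (fun κ t => ((Lc : ℝ) ^ (d + 1) * wE d Lc (j + 1)) • e3OfK Lc (coDressKBmAt (toSite r) Lc (KInvStep (d := d) Lc j))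
        (SrecAt d Lc (toSite r) ((Lc : ℝ) ^ (d + 1)) (-((Lc : ℝ) ^ (d + 1) * (1 / 2) * (Lc : ℝ) ^ (d + 1))) cΛ j) κ t) κ (t + v) =
      shiftK (-v) (unitS sf sm (fun κ t => ((Lc : ℝ) ^ (d + 1) * wE d Lc (j + 1)) • e3OfK Lc (coDressKBmAt (toSite r) Lc (KInvStep (d := d) Lc j))
        (SrecAt d Lc (toSite r) ((Lc : ℝ) ^ (d + 1)) (-((Lc : ℝ) ^ (d + 1) * (1 / 2) * (Lc : ℝ) ^ (d + 1))) cΛ j) κ t) κ t) := by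
    intro κ t v
    funext x z a c
    have h := congrFun (congrFun (congrFun (congrFun (e3Sector_translate (r := r) (d := d) hLc1 ((Lc : ℝ) ^ (d + 1)) (-((Lc : ℝ) ^ (d + 1) * (1 / 2) * (Lc : ℝ) ^ (d + 1))) cΛ j κ t v) x) z) a) c
    simp only [shiftK] at h ⊢
    simp only [unitS_apply, h]
  have hL0 : (0 : ℤ) < (Lc : ℤ) := by exact_mod_cast Nat.pos_of_ne_zero (NeZero.ne Lc)
  have hlam : ∀ w : Site (d + 1), |(((w ν % (Lc : ℤ) : ℤ) : ℝ))| ≤ (Lc : ℝ) := by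
    intro w
    rw [abs_of_nonneg (by exact_mod_cast Int.emod_nonneg _ hL0.ne')]
    exact_mod_cast (Int.emod_lt_of_pos (w ν) hL0).le
  exact sum_box_faceSlot_current_eq_zero hS hδE hScov ν b β hlam (fun z w => faceSlot_unitS_e3Sector_split hr sf sm cΛ j ν z w b β)
    (hasSum_slotLeg_unitS_e3Sector hLc hr sf sm _ _ cΛ j ν b β 0) (fun z => summable_abs_E2_row (j + 1) _ z b β) (fun z => tsum_E2_mul_face_eq_zero (j + 1) _ z b β)
    (sum_box_E2_face_sawtooth_eq_zero (j + 1) _ ν b β)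

end CellTotals

/-! ## §3 24_{j+1} under (D) alone -/

section Words

variable {S' : Fin (d + 1) → Site (d + 1) → MKer (d + 1) (Fib d)} {Cs δs : ℝ} {μ ν α β : Fin (d + 1)}

/-- [folklore] **THE `S′ ⊗ S^E` DIRECT WORD AT LEVEL `j+1` VANISHES PER BOND WHEN THE LEVEL-`(j+1)` EXIT-FACE CURRENT IS DIVERGENCE-FREE** (Ward pins, `3 ≤ Lc`, every `j`, every `cΛ`,
all units, any axes, any cell bond `c`, `S′` any local stencil family with zero ff block): C's `tsum_noFF_left_E_right_word_eq_zero_succ` with `h0` discharged by §2. -/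
theorem tsum_noFF_left_E_right_word_eq_zero_succ_of_divFree (hLc : 3 ≤ Lc) (hr : r ∈ box (d + 1) Lc) (sf sm cΛ : ℝ) (j : ℕ) (hS : LocStencil S' Cs δs) (hδs : 0 < δs)
    (hSff : ∀ (κ' : Fin (d + 1)) (t x z : Site (d + 1)) (α' a : Fin (d + 1)), S' κ' t x z (Sum.inl α') (Sum.inl a) = 0) (c : Site (d + 1))
    (hdiv : ∀ p : Site (d + 1), ∑ b : Fin (d + 1),
      ((∑' uw : Site (d + 1) × Site (d + 1), (if uw.2 β % (Lc : ℤ) = (Lc : ℤ) - 1 then (1 : ℝ) else 0) *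
        vertexOfK (unitK sf sm (coDressKBmAt (toSite r) Lc (KInvStep (d := d) Lc (j + 1)))) Lc
          (unitS sf sm (fun κ t => ((Lc : ℝ) ^ (d + 1) * wE d Lc (j + 1)) • e3OfK Lc (coDressKBmAt (toSite r) Lc (KInvStep (d := d) Lc j))
            (SrecAt d Lc (toSite r) ((Lc : ℝ) ^ (d + 1)) (-((Lc : ℝ) ^ (d + 1) * (1 / 2) * (Lc : ℝ) ^ (d + 1))) cΛ j) κ t)) ν uw.1 p uw.2 (Sum.inl b) (Sum.inl β)) -
       (∑' uw : Site (d + 1) × Site (d + 1), (if uw.2 β % (Lc : ℤ) = (Lc : ℤ) - 1 then (1 : ℝ) else 0) *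
        vertexOfK (unitK sf sm (coDressKBmAt (toSite r) Lc (KInvStep (d := d) Lc (j + 1)))) Lc
          (unitS sf sm (fun κ t => ((Lc : ℝ) ^ (d + 1) * wE d Lc (j + 1)) • e3OfK Lc (coDressKBmAt (toSite r) Lc (KInvStep (d := d) Lc j))
            (SrecAt d Lc (toSite r) ((Lc : ℝ) ^ (d + 1)) (-((Lc : ℝ) ^ (d + 1) * (1 / 2) * (Lc : ℝ) ^ (d + 1))) cΛ j) κ t)) ν uw.1 (p - unitVec b) uw.2 (Sum.inl b) (Sum.inl β))) = 0) :
    ∑' u' : Site (d + 1), ∑' yw : Site (d + 1) × Site (d + 1), (if yw.1 α % (Lc : ℤ) = (Lc : ℤ) - 1 then (1 : ℝ) else 0) * (if yw.2 β % (Lc : ℤ) = (Lc : ℤ) - 1 then (1 : ℝ) else 0) *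
        ExpKernelCalculus.comp (ExpKernelCalculus.comp (vertexOfK (unitK sf sm (coDressKBmAt (toSite r) Lc (KInvStep (d := d) Lc (j + 1)))) Lc (unitS sf sm S') μ c)
          (unitK sf sm (coDressKBmAt (toSite r) Lc (KInvStep (d := d) Lc (j + 1)))))
          (vertexOfK (unitK sf sm (coDressKBmAt (toSite r) Lc (KInvStep (d := d) Lc (j + 1)))) Lc
            (unitS sf sm (fun κ t => ((Lc : ℝ) ^ (d + 1) * wE d Lc (j + 1)) • e3OfK Lc (coDressKBmAt (toSite r) Lc (KInvStep (d := d) Lc j))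
              (SrecAt d Lc (toSite r) ((Lc : ℝ) ^ (d + 1)) (-((Lc : ℝ) ^ (d + 1) * (1 / 2) * (Lc : ℝ) ^ (d + 1))) cΛ j) κ t)) ν u')
          yw.1 yw.2 (Sum.inl α) (Sum.inl β) = 0 :=
  tsum_noFF_left_E_right_word_eq_zero_succ (le_trans (by norm_num) hLc) hr sf sm _ _ cΛ j hS hδs hSff c (fun _ _ => rfl) hdiv
    (fun b => sum_box_current_E_eq_zero hLc hr sf sm cΛ j ν β b)

/-- [folklore] **THE `S^E ⊗ S′` SWAP WORD AT LEVEL `j+1` VANISHES PER BOND WHEN THE CURRENT READ AT THE LEG `inl α` IS DIVERGENCE-FREE** (same data). -/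
theorem tsum_E_left_noFF_right_swap_word_eq_zero_succ_of_divFree (hLc : 3 ≤ Lc) (hr : r ∈ box (d + 1) Lc) (sf sm cΛ : ℝ) (j : ℕ) (hS : LocStencil S' Cs δs) (hδs : 0 < δs)
    (hSff : ∀ (κ' : Fin (d + 1)) (t x z : Site (d + 1)) (α' a : Fin (d + 1)), S' κ' t x z (Sum.inl α') (Sum.inl a) = 0) (c : Site (d + 1))
    (hdiv' : ∀ p : Site (d + 1), ∑ b : Fin (d + 1),
      ((∑' uy : Site (d + 1) × Site (d + 1), (if uy.2 α % (Lc : ℤ) = (Lc : ℤ) - 1 then (1 : ℝ) else 0) *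
        vertexOfK (unitK sf sm (coDressKBmAt (toSite r) Lc (KInvStep (d := d) Lc (j + 1)))) Lc
          (unitS sf sm (fun κ t => ((Lc : ℝ) ^ (d + 1) * wE d Lc (j + 1)) • e3OfK Lc (coDressKBmAt (toSite r) Lc (KInvStep (d := d) Lc j))
            (SrecAt d Lc (toSite r) ((Lc : ℝ) ^ (d + 1)) (-((Lc : ℝ) ^ (d + 1) * (1 / 2) * (Lc : ℝ) ^ (d + 1))) cΛ j) κ t)) ν uy.1 p uy.2 (Sum.inl b) (Sum.inl α)) -
       (∑' uy : Site (d + 1) × Site (d + 1), (if uy.2 α % (Lc : ℤ) = (Lc : ℤ) - 1 then (1 : ℝ) else 0) *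
        vertexOfK (unitK sf sm (coDressKBmAt (toSite r) Lc (KInvStep (d := d) Lc (j + 1)))) Lc
          (unitS sf sm (fun κ t => ((Lc : ℝ) ^ (d + 1) * wE d Lc (j + 1)) • e3OfK Lc (coDressKBmAt (toSite r) Lc (KInvStep (d := d) Lc j))
            (SrecAt d Lc (toSite r) ((Lc : ℝ) ^ (d + 1)) (-((Lc : ℝ) ^ (d + 1) * (1 / 2) * (Lc : ℝ) ^ (d + 1))) cΛ j) κ t)) ν uy.1 (p - unitVec b) uy.2 (Sum.inl b) (Sum.inl α))) = 0) :
    ∑' u' : Site (d + 1), ∑' yw : Site (d + 1) × Site (d + 1), (if yw.1 α % (Lc : ℤ) = (Lc : ℤ) - 1 then (1 : ℝ) else 0) * (if yw.2 β % (Lc : ℤ) = (Lc : ℤ) - 1 then (1 : ℝ) else 0) *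
        ExpKernelCalculus.comp (ExpKernelCalculus.comp (vertexOfK (unitK sf sm (coDressKBmAt (toSite r) Lc (KInvStep (d := d) Lc (j + 1)))) Lc
            (unitS sf sm (fun κ t => ((Lc : ℝ) ^ (d + 1) * wE d Lc (j + 1)) • e3OfK Lc (coDressKBmAt (toSite r) Lc (KInvStep (d := d) Lc j))
              (SrecAt d Lc (toSite r) ((Lc : ℝ) ^ (d + 1)) (-((Lc : ℝ) ^ (d + 1) * (1 / 2) * (Lc : ℝ) ^ (d + 1))) cΛ j) κ t)) ν u')
          (unitK sf sm (coDressKBmAt (toSite r) Lc (KInvStep (d := d) Lc (j + 1)))))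
          (vertexOfK (unitK sf sm (coDressKBmAt (toSite r) Lc (KInvStep (d := d) Lc (j + 1)))) Lc (unitS sf sm S') μ c)
          yw.1 yw.2 (Sum.inl α) (Sum.inl β) = 0 :=
  tsum_E_left_noFF_right_swap_word_eq_zero_succ (le_trans (by norm_num) hLc) hr sf sm _ _ cΛ j hS hδs hSff c (fun _ _ => rfl) hdiv'
    (fun b => sum_box_current_E_eq_zero hLc hr sf sm cΛ j ν α b)

end Words

end Summit.QuantumFields.BalabanUV.Beta.GAN24.ExitFaceCurrentCellTotalsStep

end
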